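import Mathlib
import Summits.Ventures.PercRepro2.Defs
import Summits.Ventures.PercRepro2.Independence
import Summits.Ventures.PercRepro2.Graph
import Summits.Ventures.PercRepro2.Exploration
import Summits.Ventures.PercRepro2.Induced
import Summits.Ventures.PercRepro2.R2PrimeThreeReduction
import Summits.Ventures.PercRepro2.YBridge
import Summits.Ventures.PercRepro2.HCov
import Summits.Ventures.PercRepro2.HCovFns
import Summits.Ventures.PercRepro2.HCovCubic
import Summits.Ventures.PercRepro2.TriDisagreement
import Summits.Ventures.PercRepro2.TriDisagreementPinned
import Summits.Ventures.PercRepro2.DAD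
import Summits.Ventures.PercRepro2.HubModel
import Summits.Ventures.PercRepro2.HubLaw
import Summits.Ventures.PercRepro2.HubRootLaw
import Summits.Ventures.PercRepro2.HubConn
import Summits.Ventures.PercRepro2.HubBernstein
import Summits.Ventures.PercRepro2.HubGc
import Summits.Ventures.PercRepro2.HubKron
import Summits.Ventures.PercRepro2.HubCert
import Summits.Ventures.PercRepro2.HubHarris
import Summits.Ventures.PercRepro2.HubKernelP1
import Summits.Ventures.PercRepro2.HubTyped
import Summits.Ventures.PercRepro2.HubTypedProfile
import Summits.Ventures.PercRepro2.HubFibre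

/-!
# Pairing the hub table with the inner count tensor
(blind cell PercRepro2, typer-1 g8; NIGHT3-CERT.md §11 (iii)–(v), the typed R theorem, part T3b)

`pair5 W N = Σ_{a b d} W a b d · N a b d` pairs an integer tensor on the atoms with a
nonnegative integer tensor `N`.  The inner count tensor `N5 = Ninner` on the atoms is symmetric
(`N5_swap12`, `N5_swap23`: exchanging copies is a bijection of the typed inner triples), carries
all of the inner count (`sum_Ninner_eq_pair5`: inconsistent patterns never occur), and satisfies
the **block inequalities** of the certificates (`block_nonneg_N5`, from `HubFibre.block_nonneg_tset`).
For a symmetric `N`, `pair5 (sym3 W) N = 6 · pair5 W N` (`pair5_sym3`), and a certificate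
pairs nonnegatively (`pair5_rhs_nonneg`).
-/

namespace Summit.Ventures.PercRepro2.Hub

open Classical

section Pair

variable {S : Type*} [Field S]

/-- The pairing of an atom tensor with a nonnegative integer tensor. -/
def pair5 (W : Fin 5 → Fin 5 → Fin 5 → ℤ) (N : Fin 5 → Fin 5 → Fin 5 → ℕ) : S :=
  ∑ a, ∑ b, ∑ d, (W a b d : S) * (N a b d : S)

/-- The pairing is additive in the tensor. -/
lemma pair5_add (W₁ W₂ : Fin 5 → Fin 5 → Fin 5 → ℤ) (N : Fin 5 → Fin 5 → Fin 5 → ℕ) :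
    pair5 (S := S) (fun a b d => W₁ a b d + W₂ a b d) N = pair5 W₁ N + pair5 W₂ N := by
  simp only [pair5, Int.cast_add, add_mul, Finset.sum_add_distrib]

/-- The pairing of a list sum of tensors is the list sum of the pairings. -/
lemma pair5_list_sum {α : Type*} (l : List α) (f : α → Fin 5 → Fin 5 → Fin 5 → ℤ)
    (N : Fin 5 → Fin 5 → Fin 5 → ℕ) :
    pair5 (S := S) (fun a b d => (l.map fun e => f e a b d).sum) N =
      (l.map fun e => pair5 (S := S) (f e) N).sum := by
  induction l with
  | nil => simp [pair5]
  | cons e l ih =>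
    simp only [List.map_cons, List.sum_cons]
    rw [← ih, ← pair5_add]

/-- A symmetric tensor on the atoms. -/
def Sym (N : Fin 5 → Fin 5 → Fin 5 → ℕ) : Prop :=
  (∀ a b d, N b a d = N a b d) ∧ ∀ a b d, N a d b = N a b d

/-- Pairing with a symmetric tensor is invariant under transposing the last two indices. -/
lemma pair5_swap23 (W : Fin 5 → Fin 5 → Fin 5 → ℤ) {N : Fin 5 → Fin 5 → Fin 5 → ℕ} (hN : Sym N) :
    pair5 (S := S) (fun a b d => W a d b) N = pair5 W N := by
  unfold pair5
  refine Finset.sum_congr rfl fun a _ => ?_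
  rw [Finset.sum_comm]
  refine Finset.sum_congr rfl fun d _ => Finset.sum_congr rfl fun b _ => ?_
  rw [hN.2 a d b]

/-- Pairing with a symmetric tensor is invariant under transposing the first two indices. -/
lemma pair5_swap12 (W : Fin 5 → Fin 5 → Fin 5 → ℤ) {N : Fin 5 → Fin 5 → Fin 5 → ℕ} (hN : Sym N) :
    pair5 (S := S) (fun a b d => W b a d) N = pair5 W N := by
  unfold pair5
  rw [Finset.sum_comm]
  refine Finset.sum_congr rfl fun b _ => Finset.sum_congr rfl fun a _ =>
    Finset.sum_congr rfl fun d _ => ?_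
  rw [hN.1 a b d]

/-- **Symmetrisation multiplies the pairing with a symmetric tensor by six.** -/
theorem pair5_sym3 (W : Fin 5 → Fin 5 → Fin 5 → ℤ) {N : Fin 5 → Fin 5 → Fin 5 → ℕ} (hN : Sym N) :
    pair5 (S := S) (sym3 W) N = 6 * pair5 W N := by
  have e1 : pair5 (S := S) (fun a b d => W a d b) N = pair5 W N := pair5_swap23 W hN
  have e2 : pair5 (S := S) (fun a b d => W b a d) N = pair5 W N := pair5_swap12 W hN
  have e3 : pair5 (S := S) (fun a b d => W b d a) N = pair5 W N :=
    (pair5_swap12 (fun a b d => W a d b) hN).trans e1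
  have e4 : pair5 (S := S) (fun a b d => W d a b) N = pair5 W N :=
    (pair5_swap23 (fun a b d => W b a d) hN).trans e2
  have e5 : pair5 (S := S) (fun a b d => W d b a) N = pair5 W N :=
    (pair5_swap12 (fun a b d => W d a b) hN).trans e4
  have : pair5 (S := S) (sym3 W) N = pair5 W N + pair5 (fun a b d => W a d b) N +
      pair5 (fun a b d => W b a d) N + pair5 (fun a b d => W b d a) N +
      pair5 (fun a b d => W d a b) N + pair5 (fun a b d => W d b a) N := by
    simp only [sym3, pair5, Int.cast_add, add_mul, Finset.sum_add_distrib]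
  rw [this, e1, e2, e3, e4, e5]
  ring

/-- The pairing of one Harris block. -/
lemma pair5_block (u v : Fin 8) (j : Fin 5) (x : ℤ) (N : Fin 5 → Fin 5 → Fin 5 → ℕ) :
    pair5 (S := S) (fun a b d => Aq u v a b * (if j = d then x else 0)) N =
      x * ∑ a, ∑ b, (Aq u v a b : S) * (N a b j : S) := by
  unfold pair5
  rw [Finset.mul_sum]
  refine Finset.sum_congr rfl fun a _ => ?_
  rw [Finset.mul_sum]
  refine Finset.sum_congr rfl fun b _ => ?_
  rw [Finset.sum_eq_single j]
  · simp only [if_true]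
    push_cast
    ring
  · intro d _ hd
    simp [Ne.symm hd]
  · intro h
    exact absurd (Finset.mem_univ _) h

/-- The pairing of one monomial. -/
lemma pair5_mono (a' b' d' : Fin 5) (x : ℤ) (N : Fin 5 → Fin 5 → Fin 5 → ℕ) :
    pair5 (S := S) (fun a b d => if a' = a ∧ b' = b ∧ d' = d then x else 0) N =
      x * N a' b' d' := by
  unfold pair5
  rw [Finset.sum_eq_single a']
  · rw [Finset.sum_eq_single b']
    · rw [Finset.sum_eq_single d']
      · simp
      · intro d _ hd
        simp [Ne.symm hd]
      · intro h
        exact absurd (Finset.mem_univ _) h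
    · intro b _ hb
      simp [Ne.symm hb]
    · intro h
      exact absurd (Finset.mem_univ _) h
  · intro a _ ha
    simp [Ne.symm ha]
  · intro h
    exact absurd (Finset.mem_univ _) h

/-- **The pairing of a certificate**: Harris blocks plus monomials. -/
theorem pair5_rhs (c : Cert) (N : Fin 5 → Fin 5 → Fin 5 → ℕ) :
    pair5 (S := S) (rhs c) N =
      (c.H.map fun e => (e.2.2.2 : S) * ∑ a, ∑ b, (Aq e.1 e.2.1 a b : S) * (N a b e.2.2.1 : S)).sum +
        (c.M.map fun e => (e.2.2.2 : S) * (N e.1 e.2.1 e.2.2.1 : S)).sum := by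
  unfold rhs
  rw [pair5_add, pair5_list_sum, pair5_list_sum]
  congr 1
  · congr 1
    refine List.map_congr_left fun e _ => ?_
    exact pair5_block e.1 e.2.1 e.2.2.1 e.2.2.2 N
  · congr 1
    refine List.map_congr_left fun e _ => ?_
    exact pair5_mono e.1 e.2.1 e.2.2.1 e.2.2.2 N

variable [LinearOrder S] [IsStrictOrderedRing S]

/-- **A certificate pairs nonnegatively** with a tensor satisfying the block inequalities. -/
theorem pair5_rhs_nonneg (c : Cert) (hc : certNonneg c = true) (N : Fin 5 → Fin 5 → Fin 5 → ℕ)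
    (hblock : ∀ u v j, 0 ≤ ∑ a, ∑ b, (Aq u v a b : S) * (N a b j : S)) :
    0 ≤ pair5 (S := S) (rhs c) N := by
  rw [pair5_rhs]
  unfold certNonneg at hc
  rw [Bool.and_eq_true, List.all_eq_true, List.all_eq_true] at hc
  refine add_nonneg (List.sum_nonneg fun x hx => ?_) (List.sum_nonneg fun x hx => ?_)
  · obtain ⟨e, he, rfl⟩ := List.mem_map.1 hx
    have := hc.1 e he
    rw [decide_eq_true_eq] at this
    exact mul_nonneg (Int.cast_nonneg this) (hblock _ _ _)
  · obtain ⟨e, he, rfl⟩ := List.mem_map.1 hx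
    have := hc.2 e he
    rw [decide_eq_true_eq] at this
    exact mul_nonneg (Int.cast_nonneg this) (Nat.cast_nonneg _)

end Pair

section N5

variable {V : Type*} {E : Type*} [Fintype E] [DecidableEq E]
  {ends : E → Sym2 V} {μ : Mark → V} {S : Type*} [Field S] [LinearOrder S] [IsStrictOrderedRing S]

/-- The inner count tensor on the atoms. -/
noncomputable def N5 (ends : E → Sym2 V) (μ : Mark → V) (F : Finset E) (z : Config E) (τ : E → ℕ)
    (a b d : Fin 5) : ℕ :=
  Ninner ends μ F z τ (atomPat a, atomPat b, atomPat d)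

/-- Exchanging on all edges replaces the configuration. -/
lemma swapOn_univ (x y : Config E) : swapOn (Finset.univ : Finset E) x y = y := by
  funext e
  simp [swapOn]

/-- Exchanging the first two copies on all edges. -/
lemma pOf_swap12_univ (t : Triple E) :
    pOf ends μ (swap12T Finset.univ t) = ((pOf ends μ t).2.1, (pOf ends μ t).1, (pOf ends μ t).2.2) := by
  simp [pOf, swap12T, swapOn_univ]

/-- Exchanging the last two copies on all edges. -/
lemma pOf_swap23_univ (t : Triple E) :
    pOf ends μ (swap23T Finset.univ t) = ((pOf ends μ t).1, (pOf ends μ t).2.2, (pOf ends μ t).2.1) := by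
  simp [pOf, swap23T, swapOn_univ]

/-- The inner count is invariant under exchanging the first two patterns. -/
lemma Ninner_swap12 (F : Finset E) (z : Config E) (τ : E → ℕ) (π : PTriple) :
    Ninner ends μ F z τ (π.2.1, π.1, π.2.2) = Ninner ends μ F z τ π := by
  unfold Ninner
  refine Finset.card_nbij' (swap12T Finset.univ) (swap12T Finset.univ) ?_ ?_ ?_ ?_
  · intro t ht
    rw [Finset.mem_coe, Finset.mem_filter, mem_tset] at ht ⊢
    refine ⟨typed_swap12 _ ht.1, ?_⟩
    rw [pOf_swap12_univ, ht.2]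
  · intro t ht
    rw [Finset.mem_coe, Finset.mem_filter, mem_tset] at ht ⊢
    refine ⟨typed_swap12 _ ht.1, ?_⟩
    rw [pOf_swap12_univ, ht.2]
  · intro t _
    exact swap12T_swap12T _ t
  · intro t _
    exact swap12T_swap12T _ t

/-- The inner count is invariant under exchanging the last two patterns. -/
lemma Ninner_swap23 (F : Finset E) (z : Config E) (τ : E → ℕ) (π : PTriple) :
    Ninner ends μ F z τ (π.1, π.2.2, π.2.1) = Ninner ends μ F z τ π := by
  unfold Ninner
  refine Finset.card_nbij' (swap23T Finset.univ) (swap23T Finset.univ) ?_ ?_ ?_ ?_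
  · intro t ht
    rw [Finset.mem_coe, Finset.mem_filter, mem_tset] at ht ⊢
    refine ⟨typed_swap23 _ ht.1, ?_⟩
    rw [pOf_swap23_univ, ht.2]
  · intro t ht
    rw [Finset.mem_coe, Finset.mem_filter, mem_tset] at ht ⊢
    refine ⟨typed_swap23 _ ht.1, ?_⟩
    rw [pOf_swap23_univ, ht.2]
  · intro t _
    exact swap23T_swap23T _ t
  · intro t _
    exact swap23T_swap23T _ t

/-- **The inner count tensor is symmetric.** -/
theorem N5_sym (F : Finset E) (z : Config E) (τ : E → ℕ) : Sym (N5 ends μ F z τ) :=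
  ⟨fun a b d => Ninner_swap12 F z τ (atomPat a, atomPat b, atomPat d),
    fun a b d => Ninner_swap23 F z τ (atomPat a, atomPat b, atomPat d)⟩

/-- An inconsistent pattern never occurs in a typed inner triple. -/
lemma Ninner_eq_zero (F : Finset E) (z : Config E) (τ : E → ℕ) {π : PTriple}
    (h : consistent π.1 = false ∨ consistent π.2.1 = false ∨ consistent π.2.2 = false) :
    Ninner ends μ F z τ π = 0 := by
  unfold Ninner
  rw [Finset.card_eq_zero, Finset.filter_eq_empty_iff]
  intro t _ hπ
  have h1 := innerPat_consistent (ends := ends) (μ := μ) t.1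
  have h2 := innerPat_consistent (ends := ends) (μ := μ) t.2.1
  have h3 := innerPat_consistent (ends := ends) (μ := μ) t.2.2
  rw [← hπ] at h
  simp only [pOf] at h
  rcases h with h | h | h <;> simp_all

/-- An inconsistent first pattern never occurs. -/
lemma Ninner_eq_zero_1 (F : Finset E) (z : Config E) (τ : E → ℕ) {π₁ : Fin 3 → Bool}
    (h : consistent π₁ = false) (π₂ π₃ : Fin 3 → Bool) :
    Ninner ends μ F z τ (π₁, π₂, π₃) = 0 :=
  Ninner_eq_zero F z τ (π := (π₁, π₂, π₃)) (Or.inl h)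

/-- An inconsistent second pattern never occurs. -/
lemma Ninner_eq_zero_2 (F : Finset E) (z : Config E) (τ : E → ℕ) (π₁ : Fin 3 → Bool)
    {π₂ : Fin 3 → Bool} (h : consistent π₂ = false) (π₃ : Fin 3 → Bool) :
    Ninner ends μ F z τ (π₁, π₂, π₃) = 0 :=
  Ninner_eq_zero F z τ (π := (π₁, π₂, π₃)) (Or.inr (Or.inl h))

/-- An inconsistent third pattern never occurs. -/
lemma Ninner_eq_zero_3 (F : Finset E) (z : Config E) (τ : E → ℕ) (π₁ π₂ : Fin 3 → Bool)
    {π₃ : Fin 3 → Bool} (h : consistent π₃ = false) :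
    Ninner ends μ F z τ (π₁, π₂, π₃) = 0 :=
  Ninner_eq_zero F z τ (π := (π₁, π₂, π₃)) (Or.inr (Or.inr h))

/-- The inner count on all patterns, paired with a tensor, is the pairing on the atoms. -/
theorem sum_Ninner_eq_pair5 (F : Finset E) (z : Config E) (τ : E → ℕ) (W : Tensor3) :
    ∑ π : PTriple, (Ninner ends μ F z τ π : S) * (W π.1 π.2.1 π.2.2 : S) =
      pair5 (S := S) (fun a b d => W (atomPat a) (atomPat b) (atomPat d)) (N5 ends μ F z τ) := by
  unfold pair5 N5
  simp only [Fintype.sum_prod_type]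
  rw [sum_atom _ (fun π hπ => by simp [Ninner_eq_zero_1 F z τ hπ])]
  refine Finset.sum_congr rfl fun a _ => ?_
  rw [sum_atom _ (fun π hπ => by simp [Ninner_eq_zero_2 F z τ _ hπ])]
  refine Finset.sum_congr rfl fun b _ => ?_
  rw [sum_atom _ (fun π hπ => by simp [Ninner_eq_zero_3 F z τ _ _ hπ])]
  refine Finset.sum_congr rfl fun d _ => ?_
  ring

omit [Fintype E] [DecidableEq E] [LinearOrder S] [IsStrictOrderedRing S] in
/-- One typed triple's contribution to the block sum. -/
lemma block_term (u v : Fin 8) (j : Fin 5) (t : Triple E) :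
    (∑ a, ∑ b, (Aq u v a b : S) *
      (if pOf ends μ t = (atomPat a, atomPat b, atomPat j) then 1 else 0)) =
      (if innerPat ends μ t.2.2 = atomPat j then 1 else 0) *
        (iuP u (innerPat ends μ t.1) * iuP v (innerPat ends μ t.1) -
          iuP u (innerPat ends μ t.1) * iuP v (innerPat ends μ t.2.1)) := by
  obtain ⟨a₀, ha₀⟩ := (consistent_iff _).1 (innerPat_consistent (ends := ends) (μ := μ) t.1)
  obtain ⟨b₀, hb₀⟩ := (consistent_iff _).1 (innerPat_consistent (ends := ends) (μ := μ) t.2.1)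
  have hp : pOf ends μ t = (atomPat a₀, atomPat b₀, innerPat ends μ t.2.2) := by
    simp only [pOf, ha₀, hb₀]
  rw [Finset.sum_eq_single a₀]
  · rw [Finset.sum_eq_single b₀]
    · rw [hp]
      simp only [Prod.mk.injEq, true_and, Aq, iu, upA, iuP, ← ha₀, ← hb₀]
      push_cast
      split_ifs <;> ring
    · intro b _ hb
      rw [hp]
      simp only [Prod.mk.injEq]
      have : ¬ atomPat b₀ = atomPat b := fun h => hb (atomPat_injective h).symm
      simp [this]
    · intro h
      exact absurd (Finset.mem_univ _) h
  · intro a _ ha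
    refine Finset.sum_eq_zero fun b _ => ?_
    rw [hp]
    simp only [Prod.mk.injEq]
    have : ¬ atomPat a₀ = atomPat a := fun h => ha (atomPat_injective h).symm
    simp [this]
  · intro h
    exact absurd (Finset.mem_univ _) h

/-- **The block inequalities hold for the inner count tensor** (fibre Harris). -/
theorem block_nonneg_N5 (F : Finset E) (z : Config E) (τ : E → ℕ)
    (hτ : ∀ e ∈ F, τ e = 1 ∨ τ e = 2) (u v : Fin 8) (j : Fin 5) :
    0 ≤ ∑ a, ∑ b, (Aq u v a b : S) * (N5 ends μ F z τ a b j : S) := by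
  have hτ' : ∀ e ∈ F \ rootEdges ends μ, τ e = 1 ∨ τ e = 2 :=
    fun e he => hτ e (Finset.mem_sdiff.1 he).1
  have key := block_nonneg_tset (ends := ends) (μ := μ) (S := S) (F \ rootEdges ends μ) z τ hτ' u v
    (fun w => innerPat ends μ w = atomPat j)
  refine le_trans key (le_of_eq ?_)
  have hN : ∀ a b : Fin 5, (N5 ends μ F z τ a b j : S) =
      ∑ t ∈ tset (F \ rootEdges ends μ) z τ,
        if pOf ends μ t = (atomPat a, atomPat b, atomPat j) then 1 else 0 := by
    intro a b
    unfold N5 Ninner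
    rw [Finset.card_filter]
    push_cast
    rfl
  simp only [hN, Finset.mul_sum]
  rw [(Finset.sum_congr rfl fun a _ => Finset.sum_comm).trans Finset.sum_comm]
  refine Finset.sum_congr rfl fun t _ => ?_
  convert (block_term (S := S) u v j t).symm

end N5

end Summit.Ventures.PercRepro2.Hub
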